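import Summits.ABC.ABC.Theorems.TwistAmplificationSharpModerateLawPlanarityFactorisation
import Literature.NumberTheory.CubicFields.CubicFieldForms
import Mathlib.NumberTheory.NumberField.ClassNumber

/-!
# Crux `TwistAmplification.SharpModerateLaw` (stmt-ABC-1975), line `unit-plane-conic-two-torsion`:
UNIFORM class representatives and units modulo squares for the lever `stub_planarityFactorisationUniform`

First helper file of the stub `stub_planarityFactorisationUniform : PlanarityFactorisationUniform`
(`…UnitPlaneFlat6Defs.lean` §3), which makes the constants of the landed lever
`stub_planarityFactorisation` (`…PlanarityFactorisation.lean`) uniform in the form `F`.  Two of the four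
`F`-dependent ingredients of `leverConst F` are repaired here, for an irreducible maximal `F` with cubic field
`K = K_F` (`RatAlgebra F`, `R(F) ≅ 𝓞 K` by `ringEquivInt F`):

* CLASS REPRESENTATIVES BY MINKOWSKI (`exists_mk0_eq_absNorm_le_sqrt`): every ideal class of `R(F)` contains an
  integral ideal of norm `≤ √|Disc F|` — Mathlib's `NumberField.exists_ideal_in_class_of_norm_le` in `𝓞 K`
  (Minkowski constant `(4/π)^{r₂}·3!/3³ ≤ (4/3)(6/27) < 1` as `r₂ ≤ 1`, `π > 3`; `Disc F = d_K` by the tree's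
  `disc_eq_discr_of_ringEquiv_ringOfIntegers`), transported along `ringEquivInt F` WITHOUT a class-group
  isomorphism: push any representative to `𝓞 K`, take Minkowski's ideal in its class, pull back, and compare classes
  through `ClassGroup.mk0_eq_mk0_iff` (`(x)·J' = (y)·J` maps back under `Ideal.map`); norms are invariant
  (`absNorm_map_ringEquivInt_symm`: isomorphic quotients).  The chosen representatives `minRep c` (norm
  `r_c ≤ √|Disc F|`) and the complement `coIdeal 𝔯` of a nonzero ideal in its norm (`(N𝔯) = 𝔯 · coIdeal 𝔯`,
  `N(coIdeal 𝔯) = (N𝔯)²`) replace the landed `classRep/classNorm/coRep`;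
* UNITS MODULO SQUARES, UNIFORMLY (`card_unitReps_le`): the landed `unitReps F` (images of `ζ·∏ fᵢ^{δᵢ}`,
  `ζ` torsion, `δ ∈ {0,1}^{rank}`) has at most `|μ(K)|·2^{rank K} = 2·2^{r₁+r₂−1} ≤ 8` elements
  (`torsionOrder_eq_two_of_odd_finrank`, `r₁ + 2r₂ = 3`).

Registered sub-goal proved here: `uniform_classRep` (class representatives of norm `≤ √|Disc F|`, stated through
`(x)·I = (y)·J` and `#(R(F)/J)`).
-/

noncomputable section

-- the mandated summit namespace `Summit.ABC.ABC` (summit = problem) trips the duplicate-namespace linter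
set_option linter.dupNamespace false

namespace Summit.ABC.ABC.Theorems.SharpModerateLaw.UnitPlane

open Literature.NumberTheory.CubicFields
open RingOfForm (omega theta RatAlgebra finrank_ratAlgebra_eq_three)
open NumberField NumberField.Units NumberField.InfinitePlace
open scoped nonZeroDivisors

section Reps

variable {F : BinaryCubic ℤ} [hF : Fact F.IsIrreducible] [hM : Fact (RingOfForm.IsMaximal F)]

/-! ## 1. The cubic field `K_F`: places, torsion units, `#unitReps ≤ 8` -/

omit hM in
/-- `r₂ ≤ 1` for the cubic field `K_F` (`r₁ + 2r₂ = 3`). -/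
theorem nrComplexPlaces_le_one : nrComplexPlaces (RatAlgebra F) ≤ 1 := by
  have h := card_add_two_mul_card_eq_rank (RatAlgebra F)
  rw [finrank_ratAlgebra_eq_three] at h
  omega

omit hM in
/-- The unit rank of `K_F` is `≤ 2` (`rank = r₁ + r₂ − 1`, `r₁ + 2r₂ = 3`). -/
theorem rank_le_two : rank (RatAlgebra F) ≤ 2 := by
  have h := card_add_two_mul_card_eq_rank (RatAlgebra F)
  have h' := card_eq_nrRealPlaces_add_nrComplexPlaces (RatAlgebra F)
  rw [finrank_ratAlgebra_eq_three] at h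
  unfold rank
  omega

omit hM in
/-- The torsion units of `K_F` are `±1`: a field of odd degree has a real place (Mathlib's
`torsionOrder_eq_two_of_odd_finrank`). -/
theorem card_torsion_eq_two : Nat.card (torsion (RatAlgebra F)) = 2 :=
  torsionOrder_eq_two_of_odd_finrank (by rw [finrank_ratAlgebra_eq_three]; decide)

/-- **Units modulo squares, uniformly: `#unitReps F ≤ 8`** (`= |μ(K_F)|·2^{rank} = 2·2^{rank} ≤ 2·4`). -/
theorem card_unitReps_le : (unitReps F).card ≤ 8 := by
  classical
  letI := Fintype.ofFinite (torsion (RatAlgebra F))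
  unfold unitReps
  refine Finset.card_image_le.trans ((Finset.card_le_univ _).trans ?_)
  rw [Fintype.card_prod, Fintype.card_fun, Fintype.card_fin, Fintype.card_fin, ← Nat.card_eq_fintype_card,
    card_torsion_eq_two]
  calc 2 * 2 ^ rank (RatAlgebra F) ≤ 2 * 2 ^ 2 := Nat.mul_le_mul_left 2 (Nat.pow_le_pow_right two_pos rank_le_two)
    _ = 8 := rfl

/-! ## 2. Class representatives of norm `≤ √|Disc F|` (Minkowski, transported along `R(F) ≅ 𝓞 K_F`) -/

/-- Norms are invariant under `R(F) ≅ 𝓞 K_F`: `N(e⁻¹ J) = N(J)` (the quotients are isomorphic). -/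
theorem absNorm_map_ringEquivInt_symm (J : Ideal (𝓞 (RatAlgebra F))) :
    Ideal.absNorm (J.map ((ringEquivInt F).symm : 𝓞 (RatAlgebra F) →+* RingOfForm F)) = Ideal.absNorm J := by
  rw [Ideal.absNorm_apply, Ideal.absNorm_apply, Submodule.cardQuot_apply, Submodule.cardQuot_apply]
  exact (Nat.card_congr (Ideal.quotientEquiv J _ (ringEquivInt F).symm rfl).toEquiv).symm

omit hM in
/-- **Minkowski's constant of a cubic field is `< 1`**: `(4/π)^{r₂}·3!/3³·√|d_K| ≤ √|d_K|`
(`r₂ ≤ 1`, `π > 3`: `(4/3)·(6/27) = 8/27`). -/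
theorem minkowskiBound_le_sqrt :
    (4 / Real.pi) ^ nrComplexPlaces (RatAlgebra F) *
        (((Module.finrank ℚ (RatAlgebra F)).factorial : ℝ) /
            (Module.finrank ℚ (RatAlgebra F) : ℝ) ^ Module.finrank ℚ (RatAlgebra F) *
          Real.sqrt |(discr (RatAlgebra F) : ℝ)|) ≤ Real.sqrt |(discr (RatAlgebra F) : ℝ)| := by
  rw [finrank_ratAlgebra_eq_three]
  have hπ := Real.pi_gt_three
  have hπ0 : 0 < Real.pi := Real.pi_pos
  have h1 : (4 / Real.pi) ^ nrComplexPlaces (RatAlgebra F) ≤ 4 / 3 := by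
    rcases Nat.le_one_iff_eq_zero_or_eq_one.mp (nrComplexPlaces_le_one (F := F)) with h | h
    · rw [h, pow_zero]; norm_num
    · rw [h, pow_one, div_le_div_iff₀ hπ0 three_pos]; linarith
  have hs : 0 ≤ Real.sqrt |(discr (RatAlgebra F) : ℝ)| := Real.sqrt_nonneg _
  have hfac : ((Nat.factorial 3 : ℕ) : ℝ) / (3 : ℝ) ^ 3 = 6 / 27 := by norm_num [Nat.factorial]
  push_cast at hfac ⊢
  rw [hfac]
  calc (4 / Real.pi) ^ nrComplexPlaces (RatAlgebra F) * (6 / 27 * Real.sqrt |(discr (RatAlgebra F) : ℝ)|)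
      ≤ 4 / 3 * (6 / 27 * Real.sqrt |(discr (RatAlgebra F) : ℝ)|) := mul_le_mul_of_nonneg_right h1 (by positivity)
    _ ≤ Real.sqrt |(discr (RatAlgebra F) : ℝ)| := by nlinarith

/-- `|Disc F|` as a real number is `|d_{K_F}|` for maximal `F` (`Disc F = d_K`). -/
theorem natAbs_disc_eq_abs_discr :
    ((F.disc.natAbs : ℕ) : ℝ) = |(discr (RatAlgebra F) : ℝ)| := by
  rw [← disc_eq_discr_of_ringEquiv_ringOfIntegers finrank_ratAlgebra_eq_three (ringEquivInt F), Nat.cast_natAbs,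
    Int.cast_abs]

/-- **Every ideal class of `R(F)` contains an integral ideal of norm `≤ √|Disc F|`** (Minkowski in `𝓞 K_F`,
transported along `e = ringEquivInt F`: push a representative `I₀ ↦ e(I₀)`, take Minkowski's `J ∼ e(I₀)`, pull back
`e⁻¹(J) ∼ I₀` because `(x)·J = (y)·e(I₀)` maps to `(e⁻¹x)·e⁻¹(J) = (e⁻¹y)·I₀`). -/
theorem exists_mk0_eq_absNorm_le_sqrt (c : ClassGroup (RingOfForm F)) :
    ∃ I : (Ideal (RingOfForm F))⁰, ClassGroup.mk0 I = c ∧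
      (Ideal.absNorm (I : Ideal (RingOfForm F)) : ℝ) ≤ Real.sqrt (F.disc.natAbs : ℝ) := by
  set K := RatAlgebra F
  set e := ringEquivInt F with he
  obtain ⟨I₀, rfl⟩ := ClassGroup.mk0_surjective c
  set J₀ : Ideal (𝓞 K) := (I₀ : Ideal (RingOfForm F)).map (e : RingOfForm F →+* 𝓞 K) with hJ₀_def
  have hJ₀ : J₀ ≠ 0 := by
    rw [Ideal.zero_eq_bot, hJ₀_def, Ne, Ideal.map_eq_bot_iff_of_injective (f := (e : RingOfForm F →+* 𝓞 K)) e.injective]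
    exact nonZeroDivisors.coe_ne_zero I₀
  obtain ⟨J, hJ, hle⟩ :=
    NumberField.exists_ideal_in_class_of_norm_le (ClassGroup.mk0 ⟨J₀, mem_nonZeroDivisors_of_ne_zero hJ₀⟩)
  obtain ⟨x, y, hx, hy, hxy⟩ := ClassGroup.mk0_eq_mk0_iff.mp hJ
  set I : Ideal (RingOfForm F) := (J : Ideal (𝓞 K)).map (e.symm : 𝓞 K →+* RingOfForm F) with hI_def
  have hI : I ≠ 0 := by
    rw [Ideal.zero_eq_bot, hI_def, Ne, Ideal.map_eq_bot_iff_of_injective (f := (e.symm : 𝓞 K →+* RingOfForm F)) e.symm.injective]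
    exact nonZeroDivisors.coe_ne_zero J
  refine ⟨⟨I, mem_nonZeroDivisors_of_ne_zero hI⟩, ?_, ?_⟩
  · rw [ClassGroup.mk0_eq_mk0_iff]
    refine ⟨e.symm x, e.symm y, (map_ne_zero_iff _ e.symm.injective).mpr hx,
      (map_ne_zero_iff _ e.symm.injective).mpr hy, ?_⟩
    have h := congrArg (Ideal.map (e.symm : 𝓞 K →+* RingOfForm F)) hxy
    simp only [Ideal.map_mul, Ideal.map_span, Set.image_singleton] at h
    rw [hJ₀_def, Ideal.map_of_equiv] at h
    exact h
  · change (Ideal.absNorm I : ℝ) ≤ _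
    rw [hI_def, absNorm_map_ringEquivInt_symm, natAbs_disc_eq_abs_discr]
    exact hle.trans minkowskiBound_le_sqrt

/-- The Minkowski-reduced representative `𝔯_c` of the class `c`: an integral ideal of norm `≤ √|Disc F|`. -/
def minRep (c : ClassGroup (RingOfForm F)) : (Ideal (RingOfForm F))⁰ := (exists_mk0_eq_absNorm_le_sqrt c).choose

/-- `[𝔯_c] = c`. -/
theorem mk0_minRep (c : ClassGroup (RingOfForm F)) : ClassGroup.mk0 (minRep c) = c :=
  (exists_mk0_eq_absNorm_le_sqrt c).choose_spec.1

/-- **`N(𝔯_c) ≤ √|Disc F|`.** -/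
theorem absNorm_minRep_le_sqrt (c : ClassGroup (RingOfForm F)) :
    (Ideal.absNorm (minRep c : Ideal (RingOfForm F)) : ℝ) ≤ Real.sqrt (F.disc.natAbs : ℝ) :=
  (exists_mk0_eq_absNorm_le_sqrt c).choose_spec.2

/-- `N(𝔯_c)² ≤ |Disc F|`. -/
theorem absNorm_minRep_sq_le (c : ClassGroup (RingOfForm F)) :
    Ideal.absNorm (minRep c : Ideal (RingOfForm F)) ^ 2 ≤ F.disc.natAbs := by
  have h := absNorm_minRep_le_sqrt c
  have h0 : (0 : ℝ) ≤ Ideal.absNorm (minRep c : Ideal (RingOfForm F)) := Nat.cast_nonneg _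
  have h2 : ((Ideal.absNorm (minRep c : Ideal (RingOfForm F)) : ℝ)) ^ 2 ≤ (F.disc.natAbs : ℝ) := by
    rw [← Real.sq_sqrt (Nat.cast_nonneg (F.disc.natAbs))]
    exact pow_le_pow_left₀ h0 h 2
  exact_mod_cast h2

/-! ### The complement of a nonzero ideal in its norm -/

/-- The complementary ideal `𝔰` of a nonzero ideal `𝔯` in its norm: `(N𝔯) = 𝔯 · 𝔰` (`N𝔯 ∈ 𝔯`). -/
def coIdeal (𝔯 : (Ideal (RingOfForm F))⁰) : Ideal (RingOfForm F) :=
  (Ideal.dvd_span_singleton.mpr (Ideal.absNorm_mem (𝔯 : Ideal (RingOfForm F))) :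
    (𝔯 : Ideal (RingOfForm F)) ∣ Ideal.span {((Ideal.absNorm (𝔯 : Ideal (RingOfForm F)) : ℕ) : RingOfForm F)}).choose

/-- `(N𝔯) = 𝔯 · 𝔰`. -/
theorem span_absNorm_eq_mul_coIdeal (𝔯 : (Ideal (RingOfForm F))⁰) :
    Ideal.span {((Ideal.absNorm (𝔯 : Ideal (RingOfForm F)) : ℕ) : RingOfForm F)} = 𝔯 * coIdeal 𝔯 :=
  (Ideal.dvd_span_singleton.mpr (Ideal.absNorm_mem (𝔯 : Ideal (RingOfForm F))) :
    (𝔯 : Ideal (RingOfForm F)) ∣ Ideal.span {((Ideal.absNorm (𝔯 : Ideal (RingOfForm F)) : ℕ) : RingOfForm F)}).choose_spec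

/-- `N(𝔰) = (N𝔯)²` (norms in `(N𝔯) = 𝔯 · 𝔰`: `(N𝔯)³ = N𝔯 · N𝔰`). -/
theorem absNorm_coIdeal (𝔯 : (Ideal (RingOfForm F))⁰) :
    Ideal.absNorm (coIdeal 𝔯) = Ideal.absNorm (𝔯 : Ideal (RingOfForm F)) ^ 2 := by
  set n := Ideal.absNorm (𝔯 : Ideal (RingOfForm F)) with hn
  have h := congrArg Ideal.absNorm (span_absNorm_eq_mul_coIdeal 𝔯)
  rw [Ideal.absNorm_span_natCast, RingOfForm.finrank_eq_three, map_mul, ← hn] at h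
  have h' : n * Ideal.absNorm (coIdeal 𝔯) = n * n ^ 2 := by rw [← h]; ring
  exact Nat.eq_of_mul_eq_mul_left (Ideal.absNorm_pos_of_nonZeroDivisors 𝔯) h'

end Reps

/-- **Uniform class representatives** (registered sub-goal `uniform_classRep` of stmt-ABC-1975): for an irreducible
maximal `F`, every nonzero ideal `I` of `R(F)` is equivalent (`(x)·I = (y)·J`, `x, y ≠ 0`) to a nonzero ideal `J` with
`#(R(F)/J) ≤ √|Disc F|` (Minkowski's theorem in `𝓞 K_F ≅ R(F)`, constant `(4/π)^{r₂}3!/3³ < 1`). -/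
theorem uniform_classRep : ∀ (F : BinaryCubic ℤ), F.IsIrreducible → RingOfForm.IsMaximal F → ∀ I : Ideal (RingOfForm F), I ≠ ⊥ → ∃ J : Ideal (RingOfForm F), J ≠ ⊥ ∧ (∃ x y : RingOfForm F, x ≠ 0 ∧ y ≠ 0 ∧ Ideal.span {x} * I = Ideal.span {y} * J) ∧ (Nat.card (RingOfForm F ⧸ J) : ℝ) ≤ Real.sqrt (F.disc.natAbs : ℝ) := by
  intro F hirr hmax I hI
  haveI : Fact F.IsIrreducible := ⟨hirr⟩
  haveI : Fact (RingOfForm.IsMaximal F) := ⟨hmax⟩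
  have hI0 : I ∈ (Ideal (RingOfForm F))⁰ := mem_nonZeroDivisors_of_ne_zero (by rwa [Ideal.zero_eq_bot])
  obtain ⟨J, hJ, hle⟩ := exists_mk0_eq_absNorm_le_sqrt (ClassGroup.mk0 ⟨I, hI0⟩)
  obtain ⟨x, y, hx, hy, hxy⟩ := ClassGroup.mk0_eq_mk0_iff.mp hJ.symm
  refine ⟨J, ?_, ⟨x, y, hx, hy, hxy⟩, ?_⟩
  · rw [← Ideal.zero_eq_bot]; exact nonZeroDivisors.coe_ne_zero J
  · rwa [Ideal.absNorm_apply, Submodule.cardQuot_apply] at hle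

end Summit.ABC.ABC.Theorems.SharpModerateLaw.UnitPlane

end
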